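import Literature.Geometry.ComplexAnalytic.PhamBrieskornFibreSymmetries
import HarnessLib

/-!
# Rotations of ONE ARBITRARY coordinate of the Pham–Brieskorn fibre have no invariants on `Hₙ₊₁(F)`; the sign change of a single
# quadratic coordinate acts as `−1` (Milnor 1968 §9 Thm. 9.1: "the eigenvalues of `r_{a*}` are the `a`-th roots of unity other than `1`")

Family `hodge`, layer `Literature/Geometry/ComplexAnalytic`; sequel of `PhamBrieskornFibreSymmetries` (§1 there:
`eq_zero_of_forall_map_rotateFibre_eq` — the rotations of the LAST coordinate of `F = {Σ zᵢ^{aᵢ} = 1}` have no non-zero invariant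
vector on `Hₙ₊₁(F)`; §2: the sign change of TWO quadratic coordinates is homotopic to the identity). Written by the prover seat
`hodge-nonav-prover-Ax` (g18) as the first brick of the «A₃ ⊕ ι LOCAL PACKAGE» (brick L6-3 of the LOC6 plan for crux K1Q
`VeryGeneralQuaternionCommutatorsInHg`, route `Summits/HodgeConjecture/HodgeConjecture/Theses/Q8SymplecticPowers.lean`): on the
Milnor fibre `{XY = S⁴ + ε} = {z₀² + z₁² + z₂⁴ = 1}` of the `A₃` point of the quaternionic quartic covers, the involution
`ι : (z₀, z₁, z₂) ↦ (−z₀, z₁, −z₂)` is (sign change of ONE quadratic coordinate) ∘ (rotation of the last coordinate by `−1`), and Milnor's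
`H̃ₙ(J) = ⊗ⱼ H̃₀(Ω_{aⱼ})` says the first factor acts by `−1`. This file PROVES, on the tree's carriers and for every coefficient field of
characteristic zero:

* §1 `PhamBrieskorn.reindexFibre` — re-indexing the coordinates along `s : ι' ≃ ι` is a homeomorphism `F_a ≃ₜ F_{a ∘ s}`.
* §2 `PhamBrieskorn.rotateCoordFibre a ha j v` — the rotation `zⱼ ↦ v zⱼ` (`v ∈ Ω_{aⱼ}`) of the coordinate `j`, a self-homeomorphism
  of `F`; it is a homomorphism in `v`, all these rotations commute, for `j = last` it is the tree's `rotateFibre`, and re-indexing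
  intertwines `rotateCoordFibre j` with `rotateCoordFibre (s⁻¹ j)`.
* §3 **`PhamBrieskorn.eq_zero_of_forall_map_rotateCoordFibre_eq`** — a class of `Hₙ₊₁(F)` (`n + 2 ≥ 2` coordinates) fixed by all
  rotations of ONE coordinate `j` is zero (transport of the last-coordinate statement along the transposition `j ↔ last`).
* §4 **`PhamBrieskorn.map_rotateCoordFibre_neg_one_apply`** — if `aⱼ = 2`, the sign change `zⱼ ↦ −zⱼ` of that single coordinate
  acts as `−1` on `Hₙ₊₁(F)` (it is an involution without non-zero fixed vector, `Ω₂ = {1, −1}`). Contrast: the sign change of a PAIR of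
  quadratic coordinates is the identity (`map_negPairFibre_eq_id`).

Nothing specific to `(2, 2, 4)` and no HC content; no named fact; rung F-H1 not moved.

## References

* [Milnor1968] J. Milnor, Singular Points of Complex Hypersurfaces, Ann. of Math. Studies 61 (1968), §9, Thm. 9.1, Lemma 9.2
  and p. 77 (`h_* = r_{a₁*} ⊗ ⋯ ⊗ r_{a_m*}`, "the eigenvalues of `r_{a*}` are clearly the `a`-th roots of unity, other than `1`").
* [Pham1965] F. Pham, Formules de Picard–Lefschetz généralisées et ramification des intégrales, Bull. Soc. Math. France 93
  (1965) 333–367, §1.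
* [HatcherAT2002] A. Hatcher, Algebraic Topology, CUP 2002, §2.1 (remark after Prop. 2.9), Cor. 2.11.
-/

noncomputable section

open Complex ContinuousMap Set CategoryTheory
open Literature.AlgebraicTopology.SingularHomology

namespace Literature.Geometry.ComplexAnalytic

namespace PhamBrieskorn

/-! ### §1 Re-indexing the coordinates of the fibre -/

section Reindex

variable {ι ι' : Type} [Fintype ι] [Fintype ι'] (a : ι → ℕ)

/-- A point of `F_a` read along `s : ι' ≃ ι` is a point of `F_{a ∘ s}`. [cite: Milnor1968, §9 p. 76] -/
theorem comp_equiv_mem_fibre (s : ι' ≃ ι) {z : ι → ℂ} (hz : z ∈ fibre a) : (z ∘ s) ∈ fibre (a ∘ s) := by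
  rw [mem_fibre] at hz ⊢
  rw [← hz]
  exact s.sum_comp (fun i => z i ^ a i)

/-- Conversely a point of `F_{a ∘ s}` read along `s⁻¹` is a point of `F_a`. [cite: Milnor1968, §9 p. 76] -/
theorem comp_equiv_symm_mem_fibre (s : ι' ≃ ι) {w : ι' → ℂ} (hw : w ∈ fibre (a ∘ s)) :
    (fun i => w (s.symm i)) ∈ fibre a := by
  rw [mem_fibre] at hw ⊢
  rw [← hw]
  calc ∑ i, w (s.symm i) ^ a i = ∑ i, (fun i' => w i' ^ a (s i')) (s.symm i) :=
        Finset.sum_congr rfl fun i _ => by simp only [Equiv.apply_symm_apply]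
    _ = ∑ i', w i' ^ a (s i') := Equiv.sum_comp s.symm (fun i' => w i' ^ a (s i'))

/-- **Re-indexing the coordinates along `s : ι' ≃ ι` is a homeomorphism `F_a ≃ₜ F_{a ∘ s}`, `z ↦ z ∘ s`.**
[cite: Milnor1968, §9 p. 76] -/
def reindexFibre (s : ι' ≃ ι) : fibre a ≃ₜ fibre (a ∘ s) where
  toFun z := ⟨(z : ι → ℂ) ∘ s, comp_equiv_mem_fibre a s z.2⟩
  invFun w := ⟨fun i => (w : ι' → ℂ) (s.symm i), comp_equiv_symm_mem_fibre a s w.2⟩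
  left_inv z := Subtype.ext (funext fun i => by simp)
  right_inv w := Subtype.ext (funext fun i => by simp)
  continuous_toFun := ((continuous_pi fun i => continuous_apply (s i)).comp continuous_subtype_val).subtype_mk _
  continuous_invFun :=
    ((continuous_pi fun i => continuous_apply (s.symm i)).comp continuous_subtype_val).subtype_mk _

/-- `reindexFibre` on points. [cite: Milnor1968, §9 p. 76] -/
@[simp] theorem reindexFibre_apply_coe (s : ι' ≃ ι) (z : fibre a) :
    ((reindexFibre a s z : fibre (a ∘ s)) : ι' → ℂ) = (z : ι → ℂ) ∘ s := rfl

/-- A homeomorphism induces an isomorphism on homology, in particular an injection (any coefficients).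
[cite: HatcherAT2002, §2.1 remark after Prop. 2.9 and Cor. 2.11] -/
theorem map_homeomorph_injective' (R : Type) [CommRing R] {X Y : Type} [TopologicalSpace X] [TopologicalSpace Y]
    (e : X ≃ₜ Y) (b : ℕ) : Function.Injective (singularHomology.map R R (e : C(X, Y)) b) :=
  ((forget (ModuleCat R)).mapIso (singularHomology.mapIso R R e b)).toEquiv.injective

end Reindex

/-! ### §2 Rotation of one coordinate -/

section RotateCoordFun

variable {ι : Type} [DecidableEq ι] (a : ι → ℕ)

/-- The vector `(1, …, v, …, 1)` (`v` in place `j`, `v ∈ Ω_{aⱼ}`) has all its `aᵢ`-th powers equal to `1`. [cite: Milnor1968, §9 p. 77] -/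
theorem mulSingle_pow (j : ι) {v : ℂ} (hv : v ∈ Omega (a j)) (i : ι) : (Pi.mulSingle j v : ι → ℂ) i ^ a i = 1 := by
  rcases eq_or_ne i j with rfl | h
  · rw [Pi.mulSingle_eq_same]; exact hv
  · rw [Pi.mulSingle_eq_of_ne h, one_pow]

/-- **Rotation of the coordinate `j`** by `v`: `zⱼ ↦ v zⱼ`, the other coordinates fixed (Milnor's `r_{aⱼ}` on the `j`-th factor).
[cite: Milnor1968, §9 p. 77] -/
def rotateCoordFun (j : ι) (v : ℂ) (z : ι → ℂ) : ι → ℂ := (Pi.mulSingle j v : ι → ℂ) * z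

/-- On the coordinate `j` the rotation multiplies by `v`. [cite: Milnor1968, §9 p. 77] -/
theorem rotateCoordFun_apply_same (j : ι) (v : ℂ) (z : ι → ℂ) : rotateCoordFun j v z j = v * z j := by
  rw [rotateCoordFun, Pi.mul_apply, Pi.mulSingle_eq_same]

/-- The other coordinates are fixed. [cite: Milnor1968, §9 p. 77] -/
theorem rotateCoordFun_apply_of_ne {i j : ι} (h : i ≠ j) (v : ℂ) (z : ι → ℂ) : rotateCoordFun j v z i = z i := by
  rw [rotateCoordFun, Pi.mul_apply, Pi.mulSingle_eq_of_ne h, one_mul]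

/-- Rotations of one coordinate compose multiplicatively. [cite: Milnor1968, §9 p. 77] -/
theorem rotateCoordFun_rotateCoordFun (j : ι) (v w : ℂ) (z : ι → ℂ) :
    rotateCoordFun j v (rotateCoordFun j w z) = rotateCoordFun j (v * w) z := by
  rw [rotateCoordFun, rotateCoordFun, rotateCoordFun, ← mul_assoc, ← Pi.mulSingle_mul]

/-- Rotation by `1` is the identity. [cite: Milnor1968, §9 p. 77] -/
theorem rotateCoordFun_one (j : ι) (z : ι → ℂ) : rotateCoordFun j 1 z = z := by
  rw [rotateCoordFun, Pi.mulSingle_one, one_mul]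

/-- Rotations of (possibly different) coordinates commute. [cite: Milnor1968, §9 p. 77] -/
theorem rotateCoordFun_comm (j k : ι) (v w : ℂ) (z : ι → ℂ) :
    rotateCoordFun j v (rotateCoordFun k w z) = rotateCoordFun k w (rotateCoordFun j v z) := by
  simp only [rotateCoordFun, ← mul_assoc, mul_comm (Pi.mulSingle j v : ι → ℂ)]

/-- Rotation is continuous. [cite: Milnor1968, §9 p. 77] -/
theorem continuous_rotateCoordFun (j : ι) (v : ℂ) : Continuous (rotateCoordFun j v) :=
  continuous_const.mul continuous_id

end RotateCoordFun

section RotateCoord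

variable {ι : Type} [Fintype ι] [DecidableEq ι] (a : ι → ℕ)

/-- Rotation of the coordinate `j` by `v ∈ Ω_{aⱼ}` preserves the fibre. [cite: Milnor1968, §9 p. 77] -/
theorem rotateCoordFun_mem_fibre (j : ι) {v : ℂ} (hv : v ∈ Omega (a j)) {z : ι → ℂ} (hz : z ∈ fibre a) :
    rotateCoordFun j v z ∈ fibre a :=
  smul_mem_fibre (mulSingle_pow a j hv) hz

variable (ha : ∀ i, a i ≠ 0)

/-- **Rotation of the coordinate `j` by `v ∈ Ω_{aⱼ}` as a self-homeomorphism of the fibre `F`.** [cite: Milnor1968, §9 p. 77] -/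
def rotateCoordFibre (j : ι) (v : Omega (a j)) : fibre a ≃ₜ fibre a where
  toFun z := ⟨rotateCoordFun j v z, rotateCoordFun_mem_fibre a j v.2 z.2⟩
  invFun z := ⟨rotateCoordFun j (v : ℂ)⁻¹ z, rotateCoordFun_mem_fibre a j (inv_mem_Omega v.2) z.2⟩
  left_inv z := Subtype.ext (by
    change rotateCoordFun j (v : ℂ)⁻¹ (rotateCoordFun j v (z : ι → ℂ)) = (z : ι → ℂ)
    rw [rotateCoordFun_rotateCoordFun, inv_mul_cancel₀ (ne_zero_of_mem_Omega (ha _) v.2), rotateCoordFun_one])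
  right_inv z := Subtype.ext (by
    change rotateCoordFun j v (rotateCoordFun j (v : ℂ)⁻¹ (z : ι → ℂ)) = (z : ι → ℂ)
    rw [rotateCoordFun_rotateCoordFun, mul_inv_cancel₀ (ne_zero_of_mem_Omega (ha _) v.2), rotateCoordFun_one])
  continuous_toFun := ((continuous_rotateCoordFun j v).comp continuous_subtype_val).subtype_mk _
  continuous_invFun := ((continuous_rotateCoordFun j _).comp continuous_subtype_val).subtype_mk _

/-- `rotateCoordFibre` on points. [cite: Milnor1968, §9 p. 77] -/
@[simp] theorem rotateCoordFibre_apply_coe (j : ι) (v : Omega (a j)) (z : fibre a) :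
    (rotateCoordFibre a ha j v z : ι → ℂ) = rotateCoordFun j v z := rfl

/-- `rotateCoordFibre j v ∘ rotateCoordFibre j w = rotateCoordFibre j (v w)`. [cite: Milnor1968, §9 p. 77] -/
theorem rotateCoordFibre_mul (j : ι) (v w : Omega (a j)) :
    (rotateCoordFibre a ha j v : C(fibre a, fibre a)).comp (rotateCoordFibre a ha j w : C(fibre a, fibre a)) =
      (rotateCoordFibre a ha j ⟨(v : ℂ) * w, mul_mem_Omega v.2 w.2⟩ : C(fibre a, fibre a)) := by
  ext z : 1
  refine Subtype.ext ?_
  change rotateCoordFun j (v : ℂ) (rotateCoordFun j (w : ℂ) (z : ι → ℂ)) = rotateCoordFun j ((v : ℂ) * w) (z : ι → ℂ)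
  rw [rotateCoordFun_rotateCoordFun]

/-- `rotateCoordFibre j 1 = id`. [cite: Milnor1968, §9 p. 77] -/
theorem rotateCoordFibre_one (j : ι) :
    (rotateCoordFibre a ha j ⟨1, one_mem_Omega _⟩ : C(fibre a, fibre a)) = ContinuousMap.id _ := by
  ext z : 1
  refine Subtype.ext ?_
  change rotateCoordFun j (1 : ℂ) (z : ι → ℂ) = (z : ι → ℂ)
  rw [rotateCoordFun_one]

/-- Rotations of coordinates commute. [cite: Milnor1968, §9 p. 77] -/
theorem rotateCoordFibre_comm (j k : ι) (v : Omega (a j)) (w : Omega (a k)) :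
    (rotateCoordFibre a ha j v : C(fibre a, fibre a)).comp (rotateCoordFibre a ha k w : C(fibre a, fibre a)) =
      (rotateCoordFibre a ha k w : C(fibre a, fibre a)).comp (rotateCoordFibre a ha j v : C(fibre a, fibre a)) := by
  ext z : 1
  refine Subtype.ext ?_
  change rotateCoordFun j (v : ℂ) (rotateCoordFun k (w : ℂ) (z : ι → ℂ)) =
    rotateCoordFun k (w : ℂ) (rotateCoordFun j (v : ℂ) (z : ι → ℂ))
  rw [rotateCoordFun_comm]

/-- **Re-indexing intertwines the rotations**: `e_s ∘ (rotation of coordinate j) = (rotation of coordinate s⁻¹ j) ∘ e_s`.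
[cite: Milnor1968, §9 p. 77] -/
theorem reindexFibre_comp_rotateCoordFibre {ι' : Type} [Fintype ι'] [DecidableEq ι'] (s : ι' ≃ ι) {j : ι} {k : ι'}
    (hk : s k = j) (v : Omega (a j)) (v' : Omega ((a ∘ s) k)) (hvv : (v' : ℂ) = v) :
    (reindexFibre a s : C(fibre a, fibre (a ∘ s))).comp (rotateCoordFibre a ha j v : C(fibre a, fibre a)) =
      (rotateCoordFibre (a ∘ s) (fun i => ha (s i)) k v' : C(fibre (a ∘ s), fibre (a ∘ s))).comp
        (reindexFibre a s : C(fibre a, fibre (a ∘ s))) := by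
  ext z : 1
  refine Subtype.ext ?_
  change ((Pi.mulSingle j (v : ℂ) : ι → ℂ) * (z : ι → ℂ)) ∘ s =
    (Pi.mulSingle k (v' : ℂ) : ι' → ℂ) * ((z : ι → ℂ) ∘ s)
  have hk' : k = s.symm j := by rw [← hk, Equiv.symm_apply_apply]
  rw [hvv, hk', ← Pi.mulSingle_comp_equiv s j (v : ℂ)]
  rfl

end RotateCoord

section Last

variable {n : ℕ} (a : Fin (n + 1) → ℕ) (ha : ∀ i, a i ≠ 0)

/-- For the LAST coordinate `rotateCoordFibre` is the tree's `rotateFibre`. [cite: Milnor1968, §9 p. 77] -/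
theorem rotateCoordFibre_last (v : Omega (a (Fin.last n))) :
    (rotateCoordFibre a ha (Fin.last n) v : C(fibre a, fibre a)) = (rotateFibre a ha v : C(fibre a, fibre a)) := by
  ext z : 1
  refine Subtype.ext (funext fun i => ?_)
  change rotateCoordFun (Fin.last n) (v : ℂ) (z : Fin (n + 1) → ℂ) i = rotateFun (v : ℂ) (z : Fin (n + 1) → ℂ) i
  refine Fin.lastCases ?_ (fun k => ?_) i
  · rw [rotateCoordFun_apply_same, rotateFun_last]
  · rw [rotateCoordFun_apply_of_ne (Fin.castSucc_lt_last k).ne, rotateFun_castSucc]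

end Last

/-! ### §3 No invariants of a single factor -/

section NoInvariants

variable (F : Type) [Field F] [CharZero F] {n : ℕ} {a : Fin (n + 2) → ℕ} (ha : ∀ i, a i ≠ 0)

/-- **A class of `Hₙ₊₁(F)` fixed by the rotations of ONE coordinate `j` vanishes** (`n + 2 ≥ 2` coordinates, coefficients in a field
of characteristic zero): the `j`-th factor `Ω_{aⱼ}` acts on `H̃ₙ₊₁(F) ≅ ⊗ₖ H̃₀(Ω_{aₖ})` through the regular representation minus the
trivial one. Proof: transport of the last-coordinate statement `eq_zero_of_forall_map_rotateFibre_eq` along the re-indexing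
homeomorphism of the transposition `j ↔ last`. [cite: Milnor1968, §9 Thm. 9.1 and p. 77] [cite: Pham1965, §1] -/
theorem eq_zero_of_forall_map_rotateCoordFibre_eq (j : Fin (n + 2)) (x : singularHomology F F (fibre a) (n + 1))
    (hx : ∀ v : Omega (a j),
      singularHomology.map F F (rotateCoordFibre a ha j v : C(fibre a, fibre a)) (n + 1) x = x) :
    x = 0 := by
  classical
  set s : Fin (n + 2) ≃ Fin (n + 2) := Equiv.swap j (Fin.last (n + 1)) with hs
  have hsl : s (Fin.last (n + 1)) = j := by rw [hs, Equiv.swap_apply_right]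
  have ha' : ∀ i, (a ∘ s) i ≠ 0 := fun i => ha (s i)
  let e : C(fibre a, fibre (a ∘ s)) := (reindexFibre a s : C(fibre a, fibre (a ∘ s)))
  set y := singularHomology.map F F e (n + 1) x with hy_def
  -- `y` is fixed by every rotation of the last coordinate of `F_{a ∘ s}`
  have hy : ∀ v' : Omega ((a ∘ s) (Fin.last (n + 1))),
      singularHomology.map F F (rotateFibre (a ∘ s) ha' v' : C(fibre (a ∘ s), fibre (a ∘ s))) (n + 1) y = y := by
    intro v'
    have hv : (v' : ℂ) ∈ Omega (a j) := by
      have h : (v' : ℂ) ^ a (s (Fin.last (n + 1))) = 1 := v'.2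
      rw [hsl] at h
      exact h
    rw [← rotateCoordFibre_last (a ∘ s) ha' v', hy_def, ← ModuleCat.comp_apply, ← singularHomology.map_comp,
      ← reindexFibre_comp_rotateCoordFibre a ha s hsl ⟨v', hv⟩ v' rfl, singularHomology.map_comp, ModuleCat.comp_apply,
      hx]
  have hy0 : y = 0 := eq_zero_of_forall_map_rotateFibre_eq F ha' y hy
  exact map_homeomorph_injective' F (reindexFibre a s) (n + 1) (by rw [map_zero]; exact hy0)

/-! ### §4 The sign change of one quadratic coordinate acts as `−1` -/

/-- `−1 ∈ Ω_{aⱼ}` when `aⱼ = 2`. [cite: Milnor1968, §9 p. 77] -/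
theorem neg_one_mem_Omega_of_eq_two {j : Fin (n + 2)} (hj : a j = 2) : (-1 : ℂ) ∈ Omega (a j) := by
  rw [mem_Omega, hj]; norm_num

/-- `Ω₂ = {1, −1}`: an element of `Ω_{aⱼ}`, `aⱼ = 2`, is `1` or `−1`. [cite: Milnor1968, §9 p. 77] -/
theorem coe_eq_one_or_eq_neg_one_of_eq_two {j : Fin (n + 2)} (hj : a j = 2) (v : Omega (a j)) :
    (v : ℂ) = 1 ∨ (v : ℂ) = -1 := by
  obtain ⟨w, hw⟩ := v
  have h : w * w = 1 := by rw [← pow_two, ← hj]; exact hw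
  exact mul_self_eq_one_iff.1 h

/-- **The sign change `zⱼ ↦ −zⱼ` of ONE quadratic coordinate (`aⱼ = 2`) acts as `−1` on `Hₙ₊₁(F)`** (`n + 2 ≥ 2` coordinates, any
coefficient field of characteristic zero): for `N = (zⱼ ↦ −zⱼ)_*`, `N² = 1` and `N x + x` is fixed by `Ω₂ = {1, −1}`, hence zero.
(Milnor: `r_{2*} = −1` on `H̃₀(Ω₂)`.) [cite: Milnor1968, §9 Thm. 9.1 and p. 77] -/
theorem map_rotateCoordFibre_neg_one_apply {j : Fin (n + 2)} (hj : a j = 2) (x : singularHomology F F (fibre a) (n + 1)) :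
    singularHomology.map F F (rotateCoordFibre a ha j ⟨-1, neg_one_mem_Omega_of_eq_two hj⟩ : C(fibre a, fibre a)) (n + 1) x =
      -x := by
  set N := singularHomology.map F F
    (rotateCoordFibre a ha j ⟨-1, neg_one_mem_Omega_of_eq_two hj⟩ : C(fibre a, fibre a)) (n + 1) with hN
  -- `N ∘ N = id`
  have hNN : ∀ z, N (N z) = z := fun z => by
    rw [hN, ← ModuleCat.comp_apply, ← singularHomology.map_comp, rotateCoordFibre_mul]
    have h1 : (⟨(-1 : ℂ) * (-1 : ℂ), mul_mem_Omega (neg_one_mem_Omega_of_eq_two hj) (neg_one_mem_Omega_of_eq_two hj)⟩ :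
        Omega (a j)) = ⟨1, one_mem_Omega _⟩ := Subtype.ext (by norm_num)
    rw [h1, rotateCoordFibre_one, singularHomology.map_id]
    rfl
  -- `N x + x` is fixed by all rotations of the coordinate `j`
  have hfix : ∀ v : Omega (a j),
      singularHomology.map F F (rotateCoordFibre a ha j v : C(fibre a, fibre a)) (n + 1) (N x + x) = N x + x := by
    intro v
    rcases coe_eq_one_or_eq_neg_one_of_eq_two hj v with hv | hv
    · have h1 : v = ⟨1, one_mem_Omega _⟩ := Subtype.ext hv
      rw [h1, rotateCoordFibre_one, singularHomology.map_id]
      rfl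
    · have h1 : v = ⟨-1, neg_one_mem_Omega_of_eq_two hj⟩ := Subtype.ext hv
      rw [h1, ← hN, map_add, hNN]
      exact add_comm _ _
  have h0 := eq_zero_of_forall_map_rotateCoordFibre_eq F ha j (N x + x) hfix
  exact eq_neg_of_add_eq_zero_left h0

/-- Operator form: `(zⱼ ↦ −zⱼ)_* = −id` on `Hₙ₊₁(F)` for a quadratic coordinate `j`. [cite: Milnor1968, §9 Thm. 9.1 and p. 77] -/
theorem hom_map_rotateCoordFibre_neg_one {j : Fin (n + 2)} (hj : a j = 2) :
    (singularHomology.map F F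
        (rotateCoordFibre a ha j ⟨-1, neg_one_mem_Omega_of_eq_two hj⟩ : C(fibre a, fibre a)) (n + 1)).hom =
      -LinearMap.id :=
  LinearMap.ext fun x => by
    rw [LinearMap.neg_apply, LinearMap.id_apply]
    exact map_rotateCoordFibre_neg_one_apply F ha hj x

end NoInvariants

end PhamBrieskorn

end Literature.Geometry.ComplexAnalytic

end
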